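/-
Copyright (c) 2026 the pub-hodgecm-mathlib formalisation cell (harness21).  Prover seat hodgecm-mathlib-B-p14 (g35): road «S3-tree» (LEAD F0P3a-plan (g11) WORD T10-2; architect A-p16 (g28)
census «S3» v3 = DEAL SHEET, acting architect F0P3-p01 (g16)), brick T1 «the `U(3)_v` tree», file T1d-C2 = THE PARENT OF A TYPE-TWO VERTEX; 2026-09-01.
-/
import Literature.NumberTheory.Automorphic.UnitaryLatticeTreeTypeTwoNormalForm   -- ★ T1d-C1 (B-p14 (g35)): the normal form `κ·t_a·κ″·N₁`, plumbing
import Literature.NumberTheory.Automorphic.UnitaryThreeSingularUnipotentClasses   -- ★ `UnitaryGroup.B₀_three_apply`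
import HarnessLib

/-!
# The lattice graph of a hermitian space — VIII: THE PARENT OF A TYPE-TWO VERTEX of the `U(3)` tree is a SELF-DUAL vertex strictly above it, one depth up
# (the three cases of the normal form: inside the root; the apartment vertex `L′_a`; a child of `κ·L_a`) (Bruhat–Tits 1972 §10; Serre, *Trees* II.1.1)

Topic `NumberTheory/Automorphic`; namespace `Literature.NumberTheory.Automorphic.UnitaryLatticeTree`.  THEOREMS ONLY (no definition, no instance, no notation, no named fact,
no `sorry`); kernel lane.  Cell `pub/hodgecm-mathlib` (D-0151), crux H413 = `stmt-HodgeConjecture-24833`; road «S3-tree», brick **T1**, sequel of ★ `UnitaryLatticeTreeTypeTwoNormalForm`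
(hypothesis `htr₂` «`U(J₀)` transitive on type-two vertices», rank-2 (hB) analogue, discharged separately).  With ★ `latticeParent_spec_of_isSelfDualLattice` and the sequel this
gives the rooted structure used by T1d-C3 (`isTree`).
HONEST LABEL: HC_CM is proved only modulo the 2 remaining named inputs (hLiu418 24832, h413 24833) until rung 0 closes; nothing printed is asserted here (elementary lattice
algebra over a valuation ring); S3 stays a print row until the road's END lands.

* §22 `scaleLattice_one`, **`latticeParent_spec_of_lt_stdLattice`** (a type-two vertex `M < 𝒪³`: depth `1`, parent `𝒪³`), `mapGL_N₁_le`, **`mapGL_N₁_eq_of_v_lt_one`** (`x₂ ∈ 𝔪` for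
  `x = κ″e₀` ⇒ `κ″·N₁ = N₁`), `latt_diagonal_three_le_iff` (comparison of `ϖ`-power diagonal lattices).
* §23 `latticeDepth_stdLattice`, `diagonal_zpow_zero_eq_one`, **`latticeParent_spec_apartment_two`** (`M = κ·L′_a`, `a ≥ 1`: parent `κ·L_{a−1}` self-dual, `M <` parent, depth drops by one),
  `coe_inv_of_coe_eq_diagonal_zpow` (`t_a⁻¹ = diag(ϖ^{-a},1,ϖ^a)`), `v_B₀_le_of_forall_v_le_right`, **`latticeDepth_child`** (`M = t_a·κ″·N₁`, `a ≥ 1`, `x₂` a unit: depth `a + 1`).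
  The parent of the child and the three-case assembly `latticeParent_spec_of_isVertexLattice_two` follow in the sequel ★ `UnitaryLatticeTreeTypeTwoChild`.

## References
* [BruhatTits1972] F. Bruhat, J. Tits, *Groupes réductifs sur un corps local I*, Publ. Math. IHÉS 41 (1972), §10.
* [Tits1979] J. Tits, *Reductive groups over local fields*, PSPM 33.1 (1979), §3.3.3.
* [Serre1980Trees] J.-P. Serre, *Trees* (1980), Ch. II §1.1.
* [Jacobowitz1962] R. Jacobowitz, *Hermitian forms over local fields*, Amer. J. Math. 84 (1962), §7–§8.
-/

set_option autoImplicit false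

noncomputable section

open scoped Valued WithZero Matrix MatrixGroups

namespace Literature.NumberTheory.Automorphic.UnitaryLatticeTree

open Literature.NumberTheory.Automorphic Literature.NumberTheory.Automorphic.HermitianLattice
open Literature.NumberTheory.Automorphic.CartanUnique

variable {K : Type*} [Field K] [Valued K ℤᵐ⁰] {σ : K →+* K} {ϖ : K} {N : ℕ}

/-! ## §22 A type-two vertex inside the root; the lattice `κ″·N₁` when `x₂ ∈ 𝔪` -/

/-- `1 · M = M`. [cite: Serre1980Trees, II.1.1] -/
theorem scaleLattice_one (M : Submodule 𝒪[K] (Fin N → K)) : scaleLattice 1 M = M := by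
  ext x; rw [mem_scaleLattice_iff one_ne_zero, inv_one, one_smul]

/-- **A type-two vertex strictly inside the root has depth `1` and parent `𝒪^N`** (unimodular `H`: `H`, `H⁻¹` integral, `det` a unit; `σ` valuation-preserving; `ϖ` a uniformiser).
[cite: Serre1980Trees, II.1.1] [cite: BruhatTits1972, §10] -/
theorem latticeParent_spec_of_lt_stdLattice (hvσ : ∀ a, Valued.v (σ a) = Valued.v a) (hϖ : Valued.v ϖ = WithZero.exp (-1 : ℤ)) {H : Matrix (Fin N) (Fin N) K} (hH : IsUnit H.det)
    (hHi : IsIntMatrix H) (hHi' : IsIntMatrix H⁻¹) {d : ℕ} {M : Submodule 𝒪[K] (Fin N → K)} (hM : IsVertexLattice σ ϖ H d M) (hlt : M < stdLattice K N) :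
    latticeDepth ϖ M = 1 ∧ latticeParent σ ϖ H M = stdLattice K N := by
  have hdet : Valued.v H.det = 1 := by
    refine le_antisymm (v_det_le_one_of_forall_v_le_one hHi) ?_
    have h2 := v_det_le_one_of_forall_v_le_one hHi'
    rw [Matrix.det_nonsing_inv, Ring.inverse_eq_inv', map_inv₀] at h2
    exact (inv_le_one₀ (zero_lt_iff.2 ((Valuation.ne_zero_iff _).2 hH.ne_zero))).1 h2
  have hϖ1 : Valued.v ϖ ≤ 1 := by rw [hϖ, ← WithZero.exp_zero, WithZero.exp_le_exp]; omega
  have hL0 : IsSelfDualLattice σ ϖ H (stdLattice K N) := isSelfDualLattice_stdLattice hHi hHi' hdet hϖ1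
  have h1 : scaleLattice (ϖ ^ 1) (stdLattice K N) ≤ M := by rw [pow_one]; exact scaleLattice_le_of_lt hvσ hH ⟨d, hM⟩ hL0 hlt.le
  have hdepth : latticeDepth ϖ M = 1 := by
    refine le_antisymm (latticeDepth_le_of_le h1) (le_latticeDepth_of_forall h1 fun j hj => ?_)
    by_contra h0
    have hj0 : j = 0 := by omega
    subst hj0
    rw [pow_zero, scaleLattice_one] at hj
    exact hlt.ne (le_antisymm hlt.le hj)
  refine ⟨hdepth, ?_⟩
  rw [latticeParent, hdepth, Nat.cast_one, sub_self, zpow_zero, scaleLattice_one]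
  refine le_antisymm inf_le_right (le_inf ?_ le_rfl)
  calc stdLattice K N = dualLatt σ H (stdLattice K N) := (dualLatt_stdLattice_eq_self σ hvσ hH hHi hHi').symm
    _ ≤ dualLatt σ H M := dualLatt_antitone σ H hlt.le

/-- `ϖ𝒪³ ≤ κ″·N₁ ≤ 𝒪³` for `κ″ ∈ K₀`. [cite: Serre1980Trees, II.1.1] -/
theorem mapGL_N₁_le {κ : unitaryGroupOfForm σ ((StdForm.antidiagonal 3).over K)} (hκ : κ ∈ unitaryInt σ ((StdForm.antidiagonal 3).over K)) (hϖ1 : Valued.v ϖ ≤ 1) (hϖ0 : ϖ ≠ 0) :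
    scaleLattice ϖ (stdLattice K 3) ≤ mapGL (κ : GL (Fin 3) K) (latt (Matrix.diagonal ![(1 : K), 1, ϖ])) ∧
      mapGL (κ : GL (Fin 3) K) (latt (Matrix.diagonal ![(1 : K), 1, ϖ])) ≤ stdLattice K 3 := by
  obtain ⟨h1, h2⟩ := scaleLattice_stdLattice_le_N₁_le (K := K) hϖ1 hϖ0
  constructor
  · rw [← mapGL_scaleLattice_stdLattice_of_mem_unitaryInt hκ ϖ]; exact (mapGL_le_mapGL_iff _ _ _).2 h1
  · conv_rhs => rw [← mapGL_stdLattice_of_mem_unitaryInt hκ]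
    exact (mapGL_le_mapGL_iff _ _ _).2 h2

/-- **If `x = κ″e₀` has `x₂ ∈ 𝔪` then `κ″·N₁ = N₁`** (`x` exactly isotropic and primitive force `x₁ ∈ 𝔪`, `x₀` a unit, so `|B₀ x y| ≤ |ϖ| ↔ |y₂| ≤ |ϖ|`; then (D2)).
[cite: BruhatTits1972, §10] [cite: Serre1980Trees, II.1.1] -/
theorem mapGL_N₁_eq_of_v_lt_one (hvσ : ∀ a, Valued.v (σ a) = Valued.v a) (hσϖ : σ ϖ = ϖ) (hϖ : Valued.v ϖ = WithZero.exp (-1 : ℤ))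
    {κ : unitaryGroupOfForm σ ((StdForm.antidiagonal 3).over K)} (hκ : κ ∈ unitaryInt σ ((StdForm.antidiagonal 3).over K))
    (hx2 : Valued.v (((κ : GL (Fin 3) K) : Matrix (Fin 3) (Fin 3) K).mulVec (Pi.single 0 1) 2) < 1) :
    mapGL (κ : GL (Fin 3) K) (latt (Matrix.diagonal ![(1 : K), 1, ϖ])) = latt (Matrix.diagonal ![(1 : K), 1, ϖ]) := by
  have hϖ0 : ϖ ≠ 0 := uniformizer_ne_zero hϖ
  have hϖ1 : Valued.v ϖ ≤ 1 := by rw [hϖ, ← WithZero.exp_zero, WithZero.exp_le_exp]; omega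
  set x := ((κ : GL (Fin 3) K) : Matrix (Fin 3) (Fin 3) K).mulVec (Pi.single 0 1) with hxdef
  obtain ⟨hxint, hxiso, i, hi⟩ := firstColumn_props (K := K) hκ
  -- `x₁ ∈ 𝔪`
  have hx1 : Valued.v (x 1) < 1 := by
    have h : σ (x 1) * x 1 = -(σ (x 0) * x 2 + σ (x 2) * x 0) := by
      rw [UnitaryGroup.B₀_three_apply] at hxiso
      linear_combination hxiso
    have hv : Valued.v (σ (x 1) * x 1) < 1 := by
      rw [h, Valuation.map_neg]
      refine (Valuation.map_add _ _ _).trans_lt (max_lt ?_ ?_)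
      · rw [map_mul, hvσ]
        calc Valued.v (x 0) * Valued.v (x 2) ≤ 1 * Valued.v (x 2) := mul_le_mul' (hxint 0) le_rfl
          _ < 1 := by rw [one_mul]; exact hx2
      · rw [map_mul, hvσ]
        calc Valued.v (x 2) * Valued.v (x 0) ≤ Valued.v (x 2) * 1 := mul_le_mul' le_rfl (hxint 0)
          _ < 1 := by rw [mul_one]; exact hx2
    rw [map_mul, hvσ] at hv
    by_contra hge
    have h1 : Valued.v (x 1) = 1 := le_antisymm (hxint 1) (not_lt.1 hge)
    rw [h1, mul_one] at hv
    exact lt_irrefl _ hv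
  -- `x₀` is a unit
  have hx0 : Valued.v (x 0) = 1 := by
    fin_cases i
    · exact hi
    · exact absurd hi hx1.ne
    · exact absurd hi hx2.ne
  -- `κ·N₁ ≤ N₁`, then (D2)
  have hN₁ := isVertexLattice_two_latt_diagonal_one_one (K := K) hσϖ hϖ1 hϖ0
  refine eq_of_le_of_isVertexLattice hvσ hϖ0 (isVertexLattice_mapGL σ ϖ _ _ κ.2 hN₁) hN₁ fun y hy => ?_
  have hyint : y ∈ stdLattice K 3 := (mapGL_N₁_le hκ hϖ1 hϖ0).2 hy
  have hB := (mem_mapGL_N₁_iff hκ hϖ0 hyint).1 hy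
  have hd : ∀ i, (![(1 : K), 1, ϖ] : Fin 3 → K) i ≠ 0 := by intro i; fin_cases i <;> simp [hϖ0]
  refine (mem_latt_diagonal_iff hd y).2 fun j => ?_
  fin_cases j
  · simp only [Fin.zero_eta, Matrix.cons_val_zero, map_one]; exact hyint 0
  · simp only [Fin.mk_one, Matrix.cons_val_one, Matrix.cons_val_zero, map_one]; exact hyint 1
  · simp only [Fin.reduceFinMk, Matrix.cons_val_two, Matrix.tail_cons, Matrix.head_cons, Nat.succ_eq_add_one]
    -- `σx₀·y₂ = B₀ x y − σx₁ y₁ − σx₂ y₀`, all of valuation `≤ |ϖ|`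
    have hϖlt : ∀ z : K, Valued.v z < 1 → Valued.v z ≤ Valued.v ϖ := fun z hz => by rw [hϖ]; exact (v_lt_one_iff z).1 hz
    have heq : σ (x 0) * y 2 = B₀ σ 3 x y - σ (x 1) * y 1 - σ (x 2) * y 0 := by rw [UnitaryGroup.B₀_three_apply]; ring
    have hv : Valued.v (σ (x 0) * y 2) ≤ Valued.v ϖ := by
      rw [heq]
      refine (Valuation.map_sub _ _ _).trans (max_le ((Valuation.map_sub _ _ _).trans (max_le hB ?_)) ?_)
      · rw [map_mul, hvσ]
        calc Valued.v (x 1) * Valued.v (y 1) ≤ Valued.v (x 1) * 1 := mul_le_mul' le_rfl (hyint 1)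
          _ ≤ Valued.v ϖ := by rw [mul_one]; exact hϖlt _ hx1
      · rw [map_mul, hvσ]
        calc Valued.v (x 2) * Valued.v (y 0) ≤ Valued.v (x 2) * 1 := mul_le_mul' le_rfl (hyint 0)
          _ ≤ Valued.v ϖ := by rw [mul_one]; exact hϖlt _ hx2
    rwa [map_mul, hvσ, hx0, one_mul] at hv

/-- Comparison of `ϖ`-power diagonal lattices at `N = 3`: `latt diag(ϖ^a,ϖ^b,ϖ^c) ≤ latt diag(ϖ^{a′},ϖ^{b′},ϖ^{c′}) ↔ a′ ≤ a ∧ b′ ≤ b ∧ c′ ≤ c` (`ϖ` a uniformiser). [cite: Serre1980Trees, II.1.1] -/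
theorem latt_diagonal_three_le_iff (hϖ : Valued.v ϖ = WithZero.exp (-1 : ℤ)) (a b c a' b' c' : ℤ) :
    latt (Matrix.diagonal ![ϖ ^ a, ϖ ^ b, ϖ ^ c]) ≤ latt (Matrix.diagonal ![ϖ ^ a', ϖ ^ b', ϖ ^ c']) ↔ a' ≤ a ∧ b' ≤ b ∧ c' ≤ c := by
  have hϖ0 : ϖ ≠ 0 := uniformizer_ne_zero hϖ
  have hd : ∀ i, (![ϖ ^ a, ϖ ^ b, ϖ ^ c] : Fin 3 → K) i ≠ 0 := by intro i; fin_cases i <;> simp [zpow_ne_zero, hϖ0]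
  have hd' : ∀ i, (![ϖ ^ a', ϖ ^ b', ϖ ^ c'] : Fin 3 → K) i ≠ 0 := by intro i; fin_cases i <;> simp [zpow_ne_zero, hϖ0]
  rw [latt_le_iff_forall_mulVec_single_mem]
  simp only [Matrix.mulVec_single_one, mem_latt_diagonal_iff hd']
  constructor
  · intro h
    have h0 := h 0 0; have h1 := h 1 1; have h2 := h 2 2
    simp only [Matrix.col_apply, Matrix.diagonal_apply_eq, Matrix.cons_val_zero, Matrix.cons_val_one, Matrix.cons_val_two,
      Matrix.tail_cons, Matrix.head_cons, Nat.succ_eq_add_one, v_uniformizer_zpow hϖ, WithZero.exp_le_exp, neg_le_neg_iff] at h0 h1 h2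
    exact ⟨h0, h1, h2⟩
  · rintro ⟨h0, h1, h2⟩ j i
    rw [Matrix.col_apply, Matrix.diagonal_apply]
    split_ifs with hij
    · subst hij
      fin_cases i <;> simp only [Fin.zero_eta, Fin.mk_one, Fin.reduceFinMk, Matrix.cons_val_zero, Matrix.cons_val_one, Matrix.cons_val_two, Matrix.tail_cons, Matrix.head_cons,
        Nat.succ_eq_add_one, v_uniformizer_zpow hϖ, WithZero.exp_le_exp, neg_le_neg_iff] <;> assumption
    · rw [map_zero]; exact zero_le

/-! ## §23 The apartment case, the child case, and the assembly -/

/-- The depth of the root is `0`. [cite: Serre1980Trees, II.1.1] -/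
theorem latticeDepth_stdLattice : latticeDepth ϖ (stdLattice K N) = 0 :=
  Nat.eq_zero_of_le_zero (Nat.sInf_le (by change scaleLattice (ϖ ^ 0) (stdLattice K N) ≤ stdLattice K N; rw [pow_zero, scaleLattice_one]))

omit [Valued K ℤᵐ⁰] in
/-- `diag(ϖ^0, 1, ϖ^{-0}) = 1`. [cite: Serre1980Trees, II.1.1] -/
theorem diagonal_zpow_zero_eq_one : (Matrix.diagonal ![ϖ ^ ((0 : ℕ) : ℤ), (1 : K), ϖ ^ (-((0 : ℕ) : ℤ))] : Matrix (Fin 3) (Fin 3) K) = 1 := by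
  rw [Nat.cast_zero, neg_zero, zpow_zero, ← Matrix.diagonal_one]
  congr 1; funext i; fin_cases i <;> rfl

/-- **THE APARTMENT CASE**: for `a ≥ 1` and `κ ∈ K₀`, the type-two vertex `M = κ·L′_a = κ·latt diag(ϖ^a,1,ϖ^{1−a})` has parent `κ·L_{a−1}`: self-dual, `> M`, of depth `a − 1 = depth M − 1`.
[cite: BruhatTits1972, §10] [cite: Serre1980Trees, II.1.1] -/
theorem latticeParent_spec_apartment_two (hd : UnramifiedLocalConjDatum σ ϖ) {κ : unitaryGroupOfForm σ ((StdForm.antidiagonal 3).over K)}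
    (hκ : κ ∈ unitaryInt σ ((StdForm.antidiagonal 3).over K)) {a : ℤ} (ha : 1 ≤ a) :
    IsSelfDualLattice σ ϖ ((StdForm.antidiagonal 3).over K)
        (latticeParent σ ϖ ((StdForm.antidiagonal 3).over K) (mapGL (κ : GL (Fin 3) K) (latt (Matrix.diagonal ![ϖ ^ a, (1 : K), ϖ ^ (1 - a)])))) ∧
      mapGL (κ : GL (Fin 3) K) (latt (Matrix.diagonal ![ϖ ^ a, (1 : K), ϖ ^ (1 - a)])) <
        latticeParent σ ϖ ((StdForm.antidiagonal 3).over K) (mapGL (κ : GL (Fin 3) K) (latt (Matrix.diagonal ![ϖ ^ a, (1 : K), ϖ ^ (1 - a)]))) ∧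
      latticeDepth ϖ (latticeParent σ ϖ ((StdForm.antidiagonal 3).over K) (mapGL (κ : GL (Fin 3) K) (latt (Matrix.diagonal ![ϖ ^ a, (1 : K), ϖ ^ (1 - a)])))) + 1 =
        latticeDepth ϖ (mapGL (κ : GL (Fin 3) K) (latt (Matrix.diagonal ![ϖ ^ a, (1 : K), ϖ ^ (1 - a)]))) := by
  have hϖ0 : ϖ ≠ 0 := uniformizer_ne_zero hd.vϖ
  have hϖ1 : Valued.v ϖ ≤ 1 := by rw [hd.vϖ, ← WithZero.exp_zero, WithZero.exp_le_exp]; omega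
  have hdepth : latticeDepth ϖ (mapGL (κ : GL (Fin 3) K) (latt (Matrix.diagonal ![ϖ ^ a, (1 : K), ϖ ^ (1 - a)]))) = a.toNat := by
    rw [latticeDepth_mapGL_of_mem_unitaryInt hκ, latticeDepth_latt_diagonal_zpow_two hd.vϖ]; congr 1; exact max_eq_left (by omega)
  -- the parent in the frame: `κ·latt diag(ϖ^{a-1}, 1, ϖ^{-(a-1)})`
  have hP : latticeParent σ ϖ ((StdForm.antidiagonal 3).over K) (mapGL (κ : GL (Fin 3) K) (latt (Matrix.diagonal ![ϖ ^ a, (1 : K), ϖ ^ (1 - a)]))) =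
      mapGL (κ : GL (Fin 3) K) (latt (Matrix.diagonal ![ϖ ^ (a - 1), (1 : K), ϖ ^ (-(a - 1))])) := by
    rw [latticeParent_mapGL_of_mem_unitaryInt hκ, latticeParent, latticeDepth_latt_diagonal_zpow_two hd.vϖ, show (max a (1 - a)).toNat = a.toNat from by
      rw [max_eq_left (by omega)], show ((a.toNat : ℕ) : ℤ) = a by omega, diagonal_one_mid_eq, dualLatt_latt_diagonal_three hd.vσ hd.σϖ hϖ0,
      latt_diagonal_three_inf_scaleLattice hd.vϖ, diagonal_one_mid_eq]
    congr 3
    funext i; fin_cases i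
    · show ϖ ^ max (-(1 - a)) (1 - a) = ϖ ^ (a - 1); congr 1; rw [max_eq_left (by omega)]; ring
    · show ϖ ^ max (-(0 : ℤ)) (1 - a) = ϖ ^ (0 : ℤ); congr 1; exact max_eq_left (by omega)
    · show ϖ ^ max (-a) (1 - a) = ϖ ^ (-(a - 1)); congr 1; rw [max_eq_right (by omega)]; ring
  have hsd : IsSelfDualLattice σ ϖ ((StdForm.antidiagonal 3).over K) (latt (Matrix.diagonal ![ϖ ^ (a - 1), (1 : K), ϖ ^ (-(a - 1))])) :=
    isSelfDualLattice_latt_diagonal_zpow hd.σσ hd.σϖ hϖ1 hϖ0 (a - 1)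
  refine ⟨by rw [hP]; exact isVertexLattice_mapGL σ ϖ _ _ κ.2 hsd, ?_, ?_⟩
  · rw [hP, mapGL_lt_mapGL_iff]
    refine lt_of_le_of_ne ?_ fun heq => ?_
    · rw [diagonal_one_mid_eq, diagonal_one_mid_eq, latt_diagonal_three_le_iff hd.vϖ]
      refine ⟨by omega, le_rfl, by omega⟩
    · have h2 := isVertexLattice_two_latt_diagonal_zpow (K := K) hd.σσ hd.σϖ hϖ1 hϖ0 a
      rw [heq] at h2
      exact absurd (type_unique hd.vσ hd.vϖ h2 hsd) (by norm_num)
  · rw [hP, hdepth, latticeDepth_mapGL_of_mem_unitaryInt hκ, latticeDepth_latt_diagonal_zpow_selfDual hd.vϖ]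
    omega

omit [Valued K ℤᵐ⁰] in
/-- The inverse matrix of the torus element: `(t_a)⁻¹ = diag(ϖ^{-a}, 1, ϖ^a)`. [cite: BruhatTits1972, §10] -/
theorem coe_inv_of_coe_eq_diagonal_zpow (hϖ0 : ϖ ≠ 0) {t : unitaryGroupOfForm σ ((StdForm.antidiagonal 3).over K)} {a : ℤ}
    (ht : ((t : GL (Fin 3) K) : Matrix (Fin 3) (Fin 3) K) = Matrix.diagonal ![ϖ ^ a, 1, ϖ ^ (-a)]) :
    (((t⁻¹ : unitaryGroupOfForm σ ((StdForm.antidiagonal 3).over K)) : GL (Fin 3) K) : Matrix (Fin 3) (Fin 3) K) = Matrix.diagonal ![ϖ ^ (-a), 1, ϖ ^ a] := by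
  rw [Subgroup.coe_inv, Matrix.coe_units_inv, ht]
  apply Matrix.inv_eq_right_inv
  rw [diagonal_three_mul, ← Matrix.diagonal_one]
  congr 1; funext i; fin_cases i
  · show ϖ ^ a * ϖ ^ (-a) = 1; rw [← zpow_add₀ hϖ0, add_neg_cancel, zpow_zero]
  · show (1 : K) * 1 = 1; rw [mul_one]
  · show ϖ ^ (-a) * ϖ ^ a = 1; rw [← zpow_add₀ hϖ0, neg_add_cancel, zpow_zero]

/-- Valuation of `B₀ x z` for integral `x` and small `z`: `|B₀ x z| ≤ r` if all `|z_i| ≤ r` (`σ` an involution preserving `v`). [cite: Omeara1963, §82F] -/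
theorem v_B₀_le_of_forall_v_le_right (hσ : ∀ a, σ (σ a) = a) (hvσ : ∀ a, Valued.v (σ a) = Valued.v a) {x z : Fin N → K} {r : ℤᵐ⁰}
    (hx : x ∈ stdLattice K N) (hz : ∀ i, Valued.v (z i) ≤ r) : Valued.v (B₀ σ N x z) ≤ r := by
  rw [← hvσ, isHermitianForm_B₀ hσ x z]
  exact v_B₀_le_of_forall_v_le hvσ hz hx

/-- **THE CHILD CASE — DEPTH**: for `a ≥ 1`, `κ″ ∈ K₀` with `(κ″e₀)₂` a UNIT and `t = t_a`, the type-two vertex `t·κ″·N₁` has depth `a + 1`. [cite: BruhatTits1972, §10] [cite: Serre1980Trees, II.1.1] -/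
theorem latticeDepth_child (hd : UnramifiedLocalConjDatum σ ϖ) {κ'' : unitaryGroupOfForm σ ((StdForm.antidiagonal 3).over K)}
    (hκ'' : κ'' ∈ unitaryInt σ ((StdForm.antidiagonal 3).over K)) {t : unitaryGroupOfForm σ ((StdForm.antidiagonal 3).over K)} {a : ℕ} (ha : 1 ≤ a)
    (ht : ((t : GL (Fin 3) K) : Matrix (Fin 3) (Fin 3) K) = Matrix.diagonal ![ϖ ^ (a : ℤ), 1, ϖ ^ (-(a : ℤ))])
    (hx2 : Valued.v (((κ'' : GL (Fin 3) K) : Matrix (Fin 3) (Fin 3) K).mulVec (Pi.single 0 1) 2) = 1) :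
    latticeDepth ϖ (mapGL (t : GL (Fin 3) K) (mapGL (κ'' : GL (Fin 3) K) (latt (Matrix.diagonal ![(1 : K), 1, ϖ])))) = a + 1 := by
  have hϖ0 : ϖ ≠ 0 := uniformizer_ne_zero hd.vϖ
  have hϖ1 : Valued.v ϖ ≤ 1 := by rw [hd.vϖ, ← WithZero.exp_zero, WithZero.exp_le_exp]; omega
  set x := ((κ'' : GL (Fin 3) K) : Matrix (Fin 3) (Fin 3) K).mulVec (Pi.single 0 1) with hxdef
  obtain ⟨hxint, -, -⟩ := firstColumn_props (K := K) hκ''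
  have htinv := coe_inv_of_coe_eq_diagonal_zpow hϖ0 ht
  have hXle := (mapGL_N₁_le hκ'' hϖ1 hϖ0).2
  -- membership of `c • e_i`-type columns
  have hmem : ∀ {j : ℕ}, scaleLattice (ϖ ^ j) (stdLattice K 3) ≤ mapGL (t : GL (Fin 3) K) (mapGL (κ'' : GL (Fin 3) K) (latt (Matrix.diagonal ![(1 : K), 1, ϖ]))) ↔
      ∀ i : Fin 3, (Matrix.diagonal ![ϖ ^ (-(a : ℤ)), (1 : K), ϖ ^ (a : ℤ)]).mulVec ((Matrix.diagonal fun _ : Fin 3 => ϖ ^ j).mulVec (Pi.single i 1)) ∈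
        mapGL (κ'' : GL (Fin 3) K) (latt (Matrix.diagonal ![(1 : K), 1, ϖ])) := by
    intro j
    rw [scaleLattice_stdLattice_eq_latt_diagonal (pow_ne_zero j hϖ0), latt_le_iff_forall_mulVec_single_mem]
    refine forall_congr' fun i => ?_
    rw [mem_mapGL_iff, ← Subgroup.coe_inv, htinv]
  have hw : scaleLattice (ϖ ^ (a + 1)) (stdLattice K 3) ≤ mapGL (t : GL (Fin 3) K) (mapGL (κ'' : GL (Fin 3) K) (latt (Matrix.diagonal ![(1 : K), 1, ϖ]))) := by
    -- `ϖ^{a+1} e_i` pulled back by `t⁻¹` lies in `ϖ𝒪³ ≤ X`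
    refine hmem.2 fun i => (mapGL_N₁_le hκ'' hϖ1 hϖ0).1 ((mem_scaleLattice_stdLattice_iff hϖ0 _).2 fun k => ?_)
    rw [Matrix.mulVec_mulVec, Matrix.diagonal_mul_diagonal, Matrix.mulVec_diagonal, Pi.single_apply]
    split_ifs
    · rw [mul_one]
      fin_cases k <;> simp only [Fin.zero_eta, Fin.mk_one, Fin.reduceFinMk, Matrix.cons_val_zero, Matrix.cons_val_one, Matrix.cons_val_two, Matrix.tail_cons,
        Matrix.head_cons, one_mul, map_mul, map_pow, v_uniformizer_zpow hd.vϖ, hd.vϖ, ← WithZero.exp_nsmul, ← WithZero.exp_add, WithZero.exp_le_exp,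
        nsmul_eq_mul] <;> push_cast <;> omega
    · rw [mul_zero, map_zero]; exact zero_le
  refine le_antisymm (latticeDepth_le_of_le hw) (le_latticeDepth_of_forall hw fun j hj => ?_)
  -- minimality: the column `i = 0` forces `j ≥ a + 1`
  have h0 := (hmem.1 hj) 0
  have hint : (Matrix.diagonal ![ϖ ^ (-(a : ℤ)), (1 : K), ϖ ^ (a : ℤ)]).mulVec ((Matrix.diagonal fun _ : Fin 3 => ϖ ^ j).mulVec (Pi.single 0 1)) ∈ stdLattice K 3 := hXle h0
  have hB := (mem_mapGL_N₁_iff hκ'' hϖ0 hint).1 h0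
  have hvec : (Matrix.diagonal ![ϖ ^ (-(a : ℤ)), (1 : K), ϖ ^ (a : ℤ)]).mulVec ((Matrix.diagonal fun _ : Fin 3 => ϖ ^ j).mulVec (Pi.single 0 1)) =
      (ϖ ^ (-(a : ℤ)) * ϖ ^ j) • (Pi.single 0 1 : Fin 3 → K) := by
    rw [Matrix.mulVec_mulVec, Matrix.diagonal_mul_diagonal, Matrix.mulVec_single_one]
    funext k; rw [Matrix.col_apply, Matrix.diagonal_apply, Pi.smul_apply, Pi.single_apply]
    split_ifs with h
    · subst h; simp
    · rw [smul_zero]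
  rw [hvec, map_smul, smul_eq_mul, B₀_single_right, show Fin.rev (0 : Fin 3) = 2 from rfl, map_mul, map_mul, hd.vσ, hx2, mul_one, map_pow, v_uniformizer_zpow hd.vϖ, hd.vϖ,
    ← WithZero.exp_nsmul, ← WithZero.exp_add, WithZero.exp_le_exp, nsmul_eq_mul] at hB
  omega

end Literature.NumberTheory.Automorphic.UnitaryLatticeTree

end
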